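import Literature.NumberTheory.Transcendental.PhilipponZeroEstimateOrder
import Literature.NumberTheory.Transcendental.GaGmZariski
import HarnessLib

/-!
# Philippon's zero estimate on `𝔾ₐ × 𝔾ₘ^n`: Leibniz calculus of words of invariant derivations

Topic `Literature/NumberTheory/Transcendental`. Third module of the inline discharge of
`Literature.NumberTheory.Transcendental.Philippon1986_GaGm` (multiplicities), on top of
`PhilipponZeroEstimateOperators.lean` / `…Order.lean` (translations `transl`, invariant derivations
`invDeriv`, words `wordDeriv`) and of the Zariski toolkit `GaGmZariski.lean` (box filtration
`GaGm.Box`, translations `GaGm.shift`, torus unit `u = Y₁⋯Y_n`). It supplies the ring-theoretic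
facts about words used by the ideals `∂^T_Σ(I)` of Roy's Prop. 3.6 (LNM 1752, Ch. 11, §3.2) in
the affine coordinate ring `B = ℂ[X, Y₁, …, Y_n]`. PROVED here (no named facts):

* `transl_eq_shift` — the two translation operators of the tree coincide (definitionally);
* `invDeriv_monomial`, **`invDeriv_comm`** — the invariant derivations act diagonally-plus-shift
  on monomials and commute pairwise; `invDeriv_mem_Box`, `wordDeriv_mem_Box` — they preserve the
  box degrees (Roy, Prop. 3.6 (iv): `c = 1` for the linear group);
* `wordsLE W N g` — the set of all `D_{u₁} ⋯ D_{u_j} g`, `j ≤ N`, `uᵢ ∈ W`; closure under further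
  letters (`wordDeriv_mem_wordsLE`);
* **Leibniz into spans** (`wordDeriv_mul_mem_span`): `D_u(a·g)` lies in the ideal generated by the
  shorter-or-equal words applied to `g` — the form of the product rule behind
  `∂(Q·J) ⊆ ∂(J)`-type inclusions (Roy, proofs of Prop. 3.6 (ii) and Prop. 3.8 Step 1);
* eigen-elements: `invDeriv_torusUnit_pow` (`D_w u^k = k(∑ v_h) u^k`) and
  **`torusUnit_pow_mul_wordDeriv_mem_span`**: `u^k · D_v g ∈ span_ℂ {D_{v'}(u^k g) ; |v'| ≤ |v|}`
  — compatibility of words with the saturation by `u` defining special ideals.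

## References

* Yu. V. Nesterenko, P. Philippon (eds.), *Introduction to Algebraic Independence Theory*,
  LNM 1752, Springer 2001, Ch. 11 (D. Roy), §3.2 (Prop. 3.6), §3.3 (Prop. 3.8, Step 1).
* P. Philippon, *Lemmes de zéros dans les groupes algébriques commutatifs*, Bull. Soc. Math.
  France 114 (1986), 355–383, §4 (Déf. 4.2, Prop. 4.3).
-/

noncomputable section

open MvPolynomial

namespace Literature.NumberTheory.Transcendental

namespace GaGm

variable {n : ℕ}

/-- The translation operators `GaGm.transl` (`PhilipponZeroEstimateOperators.lean`) and
`GaGm.shift` (`GaGmZariski.lean`) are the same algebra endomorphism. [folklore] -/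
theorem transl_eq_shift (a : GaGm n) : transl a = shift a := rfl

/-! ### Invariant derivations on monomials; commutation -/

/-- The torus weight `⟨s, v⟩ = ∑_h s_{h+1} v_h` of an exponent `s` in the direction `w = (w₀, v)`.
[folklore] -/
def torusWeight (s : Fin (n + 1) →₀ ℕ) (w : ℂ × (Fin n → ℂ)) : ℂ :=
  ∑ h : Fin n, w.2 h * (s h.succ : ℂ)

/-- `Y_h ∂/∂Y_h` acts diagonally on monomials: `Y_h ∂_h (c X^s) = s_{h} c X^s`. [folklore] -/
theorem X_mul_pderiv_monomial (i : Fin (n + 1)) (s : Fin (n + 1) →₀ ℕ) (c : ℂ) :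
    X i * pderiv i (monomial s c) = (s i : ℂ) • monomial s c := by
  rw [pderiv_monomial]
  by_cases hs : s i = 0
  · simp [hs]
  · rw [X, monomial_mul, one_mul, add_tsub_cancel_of_le
      (Finsupp.single_le_iff.mpr (Nat.one_le_iff_ne_zero.mpr hs)), smul_monomial, smul_eq_mul,
      mul_comm]

/-- **`D_w` on monomials**: `D_w(c X^s) = w₀ s₀ · c X^{s - e₀} + ⟨s, v⟩ · c X^s`. [folklore] -/
theorem invDeriv_monomial (w : ℂ × (Fin n → ℂ)) (s : Fin (n + 1) →₀ ℕ) (c : ℂ) :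
    invDeriv w (monomial s c) =
      monomial (s - Finsupp.single 0 1) (w.1 * (s 0 : ℂ) * c) + torusWeight s w • monomial s c := by
  rw [invDeriv_apply, pderiv_monomial, smul_monomial, smul_eq_mul, torusWeight, Finset.sum_smul]
  congr 1
  · congr 1; ring
  · refine Finset.sum_congr rfl fun h _ => ?_
    rw [X_mul_pderiv_monomial, smul_smul]

/-- The torus weight does not see the `X`-exponent. [folklore] -/
theorem torusWeight_sub_single_zero (s : Fin (n + 1) →₀ ℕ) (w : ℂ × (Fin n → ℂ)) :
    torusWeight (s - Finsupp.single 0 1) w = torusWeight s w := by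
  unfold torusWeight
  refine Finset.sum_congr rfl fun h _ => ?_
  rw [Finsupp.tsub_apply, Finsupp.single_apply, if_neg (Fin.succ_ne_zero h).symm, Nat.sub_zero]

/-- **The invariant derivations commute**: `D_w D_{w'} = D_{w'} D_w` (they are `ℂ`-combinations of
the pairwise commuting `∂/∂X`, `Y_h ∂/∂Y_h`). [folklore] -/
theorem invDeriv_comm (w w' : ℂ × (Fin n → ℂ)) (P : MvPolynomial (Fin (n + 1)) ℂ) :
    invDeriv w (invDeriv w' P) = invDeriv w' (invDeriv w P) := by
  induction P using MvPolynomial.induction_on' with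
  | monomial s c =>
    simp only [invDeriv_monomial, map_add, torusWeight_sub_single_zero, smul_monomial, smul_eq_mul]
    ring_nf
  | add p q hp hq => simp only [map_add, hp, hq]

/-- Words do not depend on the order of their letters: swapping two adjacent letters. [folklore] -/
theorem wordDeriv_cons_cons_comm {k : ℕ} (e e' : ℂ × (Fin n → ℂ)) (u : Fin k → ℂ × (Fin n → ℂ))
    (P : MvPolynomial (Fin (n + 1)) ℂ) :
    wordDeriv (Fin.cons e (Fin.cons e' u) : Fin (k + 1 + 1) → _) P =
      wordDeriv (Fin.cons e' (Fin.cons e u) : Fin (k + 1 + 1) → _) P := by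
  rw [wordDeriv_cons, wordDeriv_cons, wordDeriv_cons, wordDeriv_cons, invDeriv_comm]

/-! ### Box degrees are preserved -/

/-- `D_w` preserves the box pieces `Box(t)` (it does not raise partial degrees). [folklore] -/
theorem invDeriv_mem_Box {D₀ D₁ t : ℕ} (w : ℂ × (Fin n → ℂ)) {P : MvPolynomial (Fin (n + 1)) ℂ}
    (hP : P ∈ Box D₀ D₁ t) : invDeriv w P ∈ Box D₀ D₁ t := by
  classical
  have hsupp : ∀ s ∈ P.support, s ∈ boxSet (n := n) D₀ D₁ t :=
    fun s hs => (mem_restrictSupport_iff ℂ).mp hP hs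
  -- a monomial with exponent in the box lies in the box
  have hmono : ∀ (s : Fin (n + 1) →₀ ℕ) (c : ℂ), s ∈ boxSet (n := n) D₀ D₁ t →
      monomial s c ∈ Box (n := n) D₀ D₁ t := fun s c hs =>
    (mem_restrictSupport_iff ℂ).mpr fun s' hs' => by
      rw [Finset.mem_coe] at hs'
      rwa [Finset.mem_singleton.mp (support_monomial_subset hs')]
  rw [P.as_sum, map_sum]
  refine Submodule.sum_mem _ fun s hs => ?_
  rw [invDeriv_monomial]
  refine Submodule.add_mem _ (hmono _ _ ?_) (Submodule.smul_mem _ _ (hmono _ _ (hsupp s hs)))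
  obtain ⟨h0, h1⟩ := hsupp s hs
  refine ⟨?_, fun h => ?_⟩
  · rw [Finsupp.tsub_apply, Finsupp.single_eq_same]
    exact (Nat.sub_le _ _).trans h0
  · rw [Finsupp.tsub_apply, Finsupp.single_apply, if_neg (Fin.succ_ne_zero h).symm, Nat.sub_zero]
    exact h1 h

/-- Words preserve the box pieces. [folklore] -/
theorem wordDeriv_mem_Box {D₀ D₁ t k : ℕ} (u : Fin k → ℂ × (Fin n → ℂ))
    {P : MvPolynomial (Fin (n + 1)) ℂ} (hP : P ∈ Box D₀ D₁ t) : wordDeriv u P ∈ Box D₀ D₁ t := by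
  induction k generalizing P with
  | zero => exact hP
  | succ k ih =>
    rw [wordDeriv_succ]
    exact ih _ (invDeriv_mem_Box _ hP)

/-! ### Sets of words applied to a polynomial -/

/-- `wordsLE W N g = {D_{u₁} ⋯ D_{u_j} g ; j ≤ N, uᵢ ∈ W}` — all words of length `≤ N` in letters
from `W` applied to `g` (Roy's `∂^κ g`, `|κ| ≤ N`, basis-free). [cite: NesterenkoPhilippon2001, Ch. 11 Def. 3.5] -/
def wordsLE (W : Submodule ℂ (ℂ × (Fin n → ℂ))) (N : ℕ) (g : MvPolynomial (Fin (n + 1)) ℂ) :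
    Set (MvPolynomial (Fin (n + 1)) ℂ) :=
  {Q | ∃ j, j ≤ N ∧ ∃ u : Fin j → ℂ × (Fin n → ℂ), (∀ i, u i ∈ W) ∧ Q = wordDeriv u g}

/-- `g` itself is the empty word. [folklore] -/
theorem self_mem_wordsLE (W : Submodule ℂ (ℂ × (Fin n → ℂ))) (N : ℕ)
    (g : MvPolynomial (Fin (n + 1)) ℂ) : g ∈ wordsLE W N g :=
  ⟨0, Nat.zero_le _, Fin.elim0, fun i => i.elim0, rfl⟩

/-- `wordsLE` is monotone in the length bound. [folklore] -/
theorem wordsLE_mono (W : Submodule ℂ (ℂ × (Fin n → ℂ))) {N N' : ℕ} (h : N ≤ N')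
    (g : MvPolynomial (Fin (n + 1)) ℂ) : wordsLE W N g ⊆ wordsLE W N' g := by
  rintro _ ⟨j, hj, u, hu, rfl⟩
  exact ⟨j, hj.trans h, u, hu, rfl⟩

/-- **Composition of words**: a word of length `k` applied to a word of length `≤ N` applied to
`g` is a word of length `≤ k + N` applied to `g` (Roy, Lemma 3.3). [cite: NesterenkoPhilippon2001, Ch. 11 Lemma 3.3] -/
theorem wordDeriv_mem_wordsLE {W : Submodule ℂ (ℂ × (Fin n → ℂ))} {N k : ℕ}
    {g Q : MvPolynomial (Fin (n + 1)) ℂ} (hQ : Q ∈ wordsLE W N g)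
    (v : Fin k → ℂ × (Fin n → ℂ)) (hv : ∀ i, v i ∈ W) : wordDeriv v Q ∈ wordsLE W (k + N) g := by
  induction k generalizing Q with
  | zero => simpa using hQ
  | succ k ih =>
    -- split off the outermost letter `v 0`
    have hsplit : v = Fin.cons (v 0) (Fin.tail v) := (Fin.cons_self_tail v).symm
    rw [hsplit, wordDeriv_cons]
    obtain ⟨j, hj, u, hu, hju⟩ := ih hQ (Fin.tail v) (fun i => hv _)
    rw [hju, ← wordDeriv_cons]
    exact ⟨j + 1, by omega, Fin.cons (v 0) u, fun i => Fin.cases (hv 0) (fun i' => hu i') i, rfl⟩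

/-- In particular single letters: `D_e (wordsLE W N g) ⊆ wordsLE W (N+1) g`. [folklore] -/
theorem invDeriv_mem_wordsLE {W : Submodule ℂ (ℂ × (Fin n → ℂ))} {N : ℕ}
    {g Q : MvPolynomial (Fin (n + 1)) ℂ} (hQ : Q ∈ wordsLE W N g) {e : ℂ × (Fin n → ℂ)}
    (he : e ∈ W) : invDeriv e Q ∈ wordsLE W (N + 1) g := by
  have h := wordDeriv_mem_wordsLE hQ (Fin.cons e Fin.elim0 : Fin 1 → _)
    (fun i => Fin.cases he (fun i' => i'.elim0) i)
  rw [wordDeriv_cons, wordDeriv_zero, show 0 + 1 + N = N + 1 by omega] at h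
  exact h

/-! ### Leibniz into spans -/

/-- A derivation maps the ideal generated by `wordsLE W N g` into the ideal generated by
`wordsLE W (N+1) g`. [folklore] -/
theorem invDeriv_mem_span_wordsLE_succ {W : Submodule ℂ (ℂ × (Fin n → ℂ))} {N : ℕ}
    {g R : MvPolynomial (Fin (n + 1)) ℂ} (hR : R ∈ Ideal.span (wordsLE W N g))
    {e : ℂ × (Fin n → ℂ)} (he : e ∈ W) : invDeriv e R ∈ Ideal.span (wordsLE W (N + 1) g) := by
  refine Submodule.span_induction (p := fun R _ => invDeriv e R ∈ Ideal.span (wordsLE W (N + 1) g))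
    ?_ ?_ ?_ ?_ hR
  · intro Q hQ
    exact Ideal.subset_span (invDeriv_mem_wordsLE hQ he)
  · simp
  · intro x y _ _ hx hy
    rw [map_add]
    exact Ideal.add_mem _ hx hy
  · intro a x hx hx'
    rw [smul_eq_mul, Derivation.leibniz, smul_eq_mul, smul_eq_mul]
    exact Ideal.add_mem _ (Ideal.mul_mem_left _ _ hx')
      (Ideal.mul_mem_right _ _ (Ideal.span_mono (wordsLE_mono W (Nat.le_succ N) g) hx))

/-- **Leibniz into spans**: for a word `v` of length `k` in letters from `W` and any `a`,
`D_v(a · g) ∈ (wordsLE W k g)`, the ideal generated by the words of length `≤ k` applied to `g`.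
(Roy, proof of Prop. 3.6 (ii): "the formulas for differentiating a product".)
[cite: NesterenkoPhilippon2001, Ch. 11 Prop. 3.6 (ii)] -/
theorem wordDeriv_mul_mem_span {W : Submodule ℂ (ℂ × (Fin n → ℂ))} {k : ℕ}
    (v : Fin k → ℂ × (Fin n → ℂ)) (hv : ∀ i, v i ∈ W) (a g : MvPolynomial (Fin (n + 1)) ℂ) :
    wordDeriv v (a * g) ∈ Ideal.span (wordsLE W k g) := by
  induction k generalizing a with
  | zero =>
    rw [wordDeriv_zero]
    exact Ideal.mul_mem_left _ a (Ideal.subset_span (self_mem_wordsLE W 0 g))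
  | succ k ih =>
    have hsplit : v = Fin.cons (v 0) (Fin.tail v) := (Fin.cons_self_tail v).symm
    rw [hsplit, wordDeriv_cons]
    exact invDeriv_mem_span_wordsLE_succ (ih (Fin.tail v) (fun i => hv _) a) (hv 0)

/-- Precise Leibniz for a word against a factor `a`: `D_v(a·g) - a·D_v g` lies in the ideal
generated by the products `(D_{v'} a) · (D_{v''} g)` with `|v''| < |v|` — recorded in the weak form
`D_v(a·g) - a·D_v g ∈ (wordsLE W (k-1) g)` for `k ≥ 1`. [folklore] -/
theorem wordDeriv_mul_sub_mem_span {W : Submodule ℂ (ℂ × (Fin n → ℂ))} {k : ℕ}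
    (v : Fin (k + 1) → ℂ × (Fin n → ℂ)) (hv : ∀ i, v i ∈ W) (a g : MvPolynomial (Fin (n + 1)) ℂ) :
    wordDeriv v (a * g) - a * wordDeriv v g ∈ Ideal.span (wordsLE W k g) := by
  induction k generalizing a with
  | zero =>
    have hv1 : v = Fin.cons (v 0) Fin.elim0 := by
      funext i; refine Fin.cases rfl (fun j => j.elim0) i
    rw [hv1, wordDeriv_cons, wordDeriv_cons, wordDeriv_zero, wordDeriv_zero, Derivation.leibniz,
      smul_eq_mul, smul_eq_mul, add_sub_cancel_left]
    exact Ideal.mul_mem_right _ _ (Ideal.subset_span (self_mem_wordsLE W 0 g))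
  | succ k ih =>
    have hsplit : v = Fin.cons (v 0) (Fin.tail v) := (Fin.cons_self_tail v).symm
    rw [hsplit, wordDeriv_cons, wordDeriv_cons]
    set e := v 0 with he
    set v' := Fin.tail v with hv'
    have hv'W : ∀ i, v' i ∈ W := fun i => hv _
    -- `D_{v'}(a g) = a D_{v'} g + r`, `r ∈ (wordsLE W k g)`
    have hr := ih v' hv'W a
    set r := wordDeriv v' (a * g) - a * wordDeriv v' g with hr_def
    have hexp : wordDeriv v' (a * g) = a * wordDeriv v' g + r := by rw [hr_def]; ring
    rw [hexp, map_add, Derivation.leibniz, smul_eq_mul, smul_eq_mul]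
    have e1 : a * invDeriv e (wordDeriv v' g) + wordDeriv v' g * invDeriv e a + invDeriv e r -
        a * invDeriv e (wordDeriv v' g) = wordDeriv v' g * invDeriv e a + invDeriv e r := by ring
    rw [e1]
    refine Ideal.add_mem _ (Ideal.mul_mem_right _ _ (Ideal.subset_span ?_))
      (invDeriv_mem_span_wordsLE_succ hr (hv 0))
    exact ⟨k + 1, le_rfl, v', hv'W, rfl⟩

/-! ### Eigen-elements: the torus unit and saturation -/

/-- `D_w u = (∑_h v_h) u` for the torus unit `u = Y₁⋯Y_n`. [folklore] -/
theorem invDeriv_torusUnit (w : ℂ × (Fin n → ℂ)) :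
    invDeriv w (torusUnit n) = (∑ h : Fin n, w.2 h) • torusUnit n := by
  classical
  have key : ∀ s : Finset (Fin n), invDeriv w (∏ h ∈ s, X h.succ) =
      (∑ h ∈ s, w.2 h) • ∏ h ∈ s, (X h.succ : MvPolynomial (Fin (n + 1)) ℂ) := by
    intro s
    induction s using Finset.induction_on with
    | empty => simp
    | insert a s ha ih =>
      rw [Finset.prod_insert ha, Finset.sum_insert ha, Derivation.leibniz, ih, invDeriv_X_succ,
        smul_eq_mul, smul_eq_mul, add_smul, MvPolynomial.smul_eq_C_mul, MvPolynomial.smul_eq_C_mul,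
        MvPolynomial.smul_eq_C_mul]
      ring
  exact key Finset.univ

/-- `D_w u^k = k (∑_h v_h) u^k`. [folklore] -/
theorem invDeriv_torusUnit_pow (w : ℂ × (Fin n → ℂ)) (k : ℕ) :
    invDeriv w (torusUnit n ^ k) = ((k : ℂ) * ∑ h : Fin n, w.2 h) • torusUnit n ^ k := by
  induction k with
  | zero => simp
  | succ k ih =>
    rw [pow_succ, Derivation.leibniz, ih, invDeriv_torusUnit]
    simp only [smul_eq_mul, MvPolynomial.smul_eq_C_mul, map_mul, map_natCast, Nat.cast_succ,
      map_add, map_one]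
    ring

/-- `wordsLT W k g` — the words of length `< k` in letters from `W` applied to `g`. [folklore] -/
def wordsLT (W : Submodule ℂ (ℂ × (Fin n → ℂ))) (k : ℕ) (g : MvPolynomial (Fin (n + 1)) ℂ) :
    Set (MvPolynomial (Fin (n + 1)) ℂ) :=
  {Q | ∃ j, j < k ∧ ∃ u : Fin j → ℂ × (Fin n → ℂ), (∀ i, u i ∈ W) ∧ Q = wordDeriv u g}

/-- `D_e` maps the `ℂ`-span of `wordsLT W k g` into that of `wordsLT W (k+1) g`, for `e ∈ W`.
[folklore] -/
theorem invDeriv_mem_span_wordsLT_succ {W : Submodule ℂ (ℂ × (Fin n → ℂ))} {k : ℕ}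
    {g R : MvPolynomial (Fin (n + 1)) ℂ} (hR : R ∈ Submodule.span ℂ (wordsLT W k g))
    {e : ℂ × (Fin n → ℂ)} (he : e ∈ W) : invDeriv e R ∈ Submodule.span ℂ (wordsLT W (k + 1) g) := by
  refine Submodule.span_induction (p := fun R _ => invDeriv e R ∈ Submodule.span ℂ (wordsLT W (k + 1) g))
    ?_ ?_ ?_ ?_ hR
  · rintro _ ⟨j, hj, u, hu, rfl⟩
    refine Submodule.subset_span ⟨j + 1, by omega, Fin.cons e u,
      fun i => Fin.cases he (fun i' => hu i') i, ?_⟩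
    rw [wordDeriv_cons]
  · simp
  · intro x y _ _ hx hy
    rw [map_add]; exact Submodule.add_mem _ hx hy
  · intro c x _ hx
    rw [Derivation.map_smul]; exact Submodule.smul_mem _ _ hx

/-- Words against an eigen-element: if `D_w a ∈ ℂ a` for all `w`, then for every word `v` of
length `k`, `D_v(a g) = a · (D_v g + R)` with `R` a `ℂ`-combination of shorter words (in the
letters of `W`) applied to `g`. [folklore] -/
theorem wordDeriv_eigen_mul {W : Submodule ℂ (ℂ × (Fin n → ℂ))} {a : MvPolynomial (Fin (n + 1)) ℂ}
    (ha : ∀ w : ℂ × (Fin n → ℂ), ∃ c : ℂ, invDeriv w a = c • a) {k : ℕ}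
    (v : Fin k → ℂ × (Fin n → ℂ)) (hv : ∀ i, v i ∈ W) (g : MvPolynomial (Fin (n + 1)) ℂ) :
    ∃ R ∈ Submodule.span ℂ (wordsLT W k g), wordDeriv v (a * g) = a * (wordDeriv v g + R) := by
  induction k with
  | zero => exact ⟨0, Submodule.zero_mem _, by simp⟩
  | succ k ih =>
    have hsplit : v = Fin.cons (v 0) (Fin.tail v) := (Fin.cons_self_tail v).symm
    obtain ⟨R', hR', hR'eq⟩ := ih (Fin.tail v) (fun i => hv _)
    obtain ⟨c, hc⟩ := ha (v 0)
    -- `D_e (a (D_{v'} g + R')) = c a (…) + a (D_e D_{v'} g + D_e R')`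
    refine ⟨c • (wordDeriv (Fin.tail v) g + R') + invDeriv (v 0) R', ?_, ?_⟩
    · refine Submodule.add_mem _ (Submodule.smul_mem _ _ (Submodule.add_mem _
        (Submodule.subset_span ⟨k, Nat.lt_succ_self k, Fin.tail v, fun i => hv _, rfl⟩)
        (Submodule.span_mono ?_ hR'))) (invDeriv_mem_span_wordsLT_succ hR' (hv 0))
      rintro _ ⟨j, hj, u, hu, rfl⟩
      exact ⟨j, by omega, u, hu, rfl⟩
    · rw [hsplit, wordDeriv_cons, wordDeriv_cons, hR'eq, Derivation.leibniz, hc, map_add]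
      simp only [smul_eq_mul, Fin.cons_zero, Fin.tail_cons]
      rw [MvPolynomial.smul_eq_C_mul, MvPolynomial.smul_eq_C_mul]
      ring

/-- **Saturation compatibility of words**: `u^k · D_v g` is a `ℂ`-combination of the words of
length `≤ |v|` applied to `u^k g` (`u = Y₁⋯Y_n` the torus unit). [folklore] -/
theorem torusUnit_pow_mul_wordDeriv_mem_span {W : Submodule ℂ (ℂ × (Fin n → ℂ))} (k : ℕ) {j : ℕ}
    (v : Fin j → ℂ × (Fin n → ℂ)) (hv : ∀ i, v i ∈ W) (g : MvPolynomial (Fin (n + 1)) ℂ) :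
    torusUnit n ^ k * wordDeriv v g ∈ Submodule.span ℂ (wordsLE W j (torusUnit n ^ k * g)) := by
  -- strong induction on the length `j`
  induction j using Nat.strong_induction_on generalizing g with
  | _ j ih =>
    have ha : ∀ w : ℂ × (Fin n → ℂ), ∃ c : ℂ, invDeriv w (torusUnit n ^ k) = c • torusUnit n ^ k :=
      fun w => ⟨_, invDeriv_torusUnit_pow w k⟩
    obtain ⟨R, hR, hReq⟩ := wordDeriv_eigen_mul ha v hv g
    -- `u^k D_v g = D_v(u^k g) - u^k R`
    have e1 : torusUnit n ^ k * wordDeriv v g =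
        wordDeriv v (torusUnit n ^ k * g) - torusUnit n ^ k * R := by
      rw [hReq]; ring
    rw [e1]
    refine Submodule.sub_mem _ (Submodule.subset_span ⟨j, le_rfl, v, hv, rfl⟩) ?_
    -- `u^k R` with `R` in the span of shorter words: induction hypothesis termwise
    refine Submodule.span_induction (p := fun R _ => torusUnit n ^ k * R ∈
        Submodule.span ℂ (wordsLE W j (torusUnit n ^ k * g))) ?_ ?_ ?_ ?_ hR
    · rintro _ ⟨j', hj', v', hv', rfl⟩
      exact Submodule.span_mono (wordsLE_mono W hj'.le _) (ih j' hj' v' hv' g)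
    · simp
    · intro x y _ _ hx hy
      rw [mul_add]; exact Submodule.add_mem _ hx hy
    · intro c x _ hx
      rw [mul_smul_comm]; exact Submodule.smul_mem _ _ hx

end GaGm

end Literature.NumberTheory.Transcendental
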